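import Summits.NavierStokesRegularity.FluidComputer.SobolevLadderFront
import Summits.NavierStokesRegularity.NavierStokesRegularity.Theorems.FluidComputerCascade
import Literature.Analysis.FunctionSpaces.FourierSobolevNormEmbeddingSubcritical
import HarnessLib

/-!
# Fluid computer — the SOBOLEV LADDER in the printed currency (L52): `Ḣ^s(ℝ³)` blow-up rates,
# `1/2 < s < 3/2`, with the scaling-sharp exponent (Robinson–Sadowski–Silva / Robinson–Sadowski on `ℝ³`)

HONEST FRAMING (cell `pub-fluidc`, verbatim): *low prior, high value-of-information experiment on Tao's
machine paradigm; NOT a claim that NS blows up.* Theorem side of the cell; nothing here is evidence of blow-up.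

`SobolevLadder` (L51) typed the ladder of clocks in the `Ḃ^s_{2,1}` currency `∑_j 2^{sj} ‖Δ̇_j u(t)‖₂` — weaker than
the printed `Ḣ^s` statement for `s < 3/2`. With the subcritical Sobolev embedding
`Ḣ^s(ℝ³) ⊂ L^{6/(3−2s)}(ℝ³)` now PROVED in the tree for every `0 < s < 3/2`
(`Literature.Analysis.FunctionSpaces.eLpNorm_le_eHomSobolevSeminorm_of_lt_threeHalves`, Bahouri–Chemin–Danchin
Thm. 1.38 for `d = 3`, this generation's Literature file), Leray's `L^r` clocks (L21′) give the PRINTED form: for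
every `s ∈ (1/2, 3/2)` there is `c_s > 0` with

  `c_s · ν^{(5−2s)/4} · (T − t)^{−(2s−1)/4} ≤ ‖u(t)‖_{Ḣ^s}` at EVERY `t ∈ (0, T)` (`homSobolev_clock`, **L52**)

along every maximal smooth solution of the unforced Navier–Stokes system on `ℝ³ × [0, T)` (`ν > 0`) which is
Leray–Hopf from `u 0`, `‖·‖_{Ḣ^s}` the Fourier-side seminorm `(∫ ‖ξ‖^{2s} ‖𝓕u(t)(ξ)‖² dξ)^{1/2}`
(`Function.eHomSobolevSeminorm s`). This is Robinson–Sadowski 2014, Cor. 10 (`1/2 < s < 3/2`, the exponent of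
Robinson–Sadowski–Silva 2012) for the dictionary's class — no boundedness or decay hypothesis (interior boundedness
and the restart at an a.e.-good time were discharged in L21′); the endpoints are gen 15's rate-free critical
divergence `CriticalDivergence.eHomSobolevSeminorm_half_tendsto_top` (`s = 1/2`) and Leray's enstrophy clock L19
(`s = 1`, where `‖u‖_{Ḣ¹}² = ∫|∇u|²` and the exponent is `1/4`).

* `homSobolev_clock_exponent` — Lebesgue-exponent form (`3 < r < ∞`, `s = 3/2 − 3/r`);
* `homSobolev_clock` (**L52**) — the `Ḣ^s` clock, `s ∈ (1/2, 3/2)`;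
* `homSobolev_tendsto_top` (**L52′**) — `‖u(t)‖_{Ḣ^s} → ∞` as `t ↑ T`, `s ∈ (1/2, 3/2)`;
* `homSobolev_clock_of_cascadeWitness` — read on the cell's interface (every `CascadeWitness`).

Reading for the atlas. For a pseudo-spectral run the `Ḣ^s` row is the spectrum moment `(∑_k |k|^{2s} E(k,t))^{1/2}`;
the necessity says that on log axes against `T − t` it eventually lies above a line of slope `−(2s−1)/4`, for EVERY
`s` strictly between the critical index `1/2` and `3/2`, with the slopes rigidly linear in `s`. HONEST SIZE NOTE:
`c_s` inexplicit (Leray's `L^r` constant × the embedding constant `(4p/(p−2))^{1/p}(2J_s^{1/2})^{(p−2)/p}`,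
`p = 6/(3−2s)`, which degenerates at both ends); `s ≥ 3/2` is not covered (the printed `Ḣ^{3/2}`, `Ḣ^{5/2}` results
of Cortissoz–Montero–Pinilla / McCormick et al. need the `Ḣ^s` energy method, not in the tree); class = `ℝ³` finite
energy. Words and shapes for the writer, never numbers at the cell's levels. Necessity only; nothing about
sufficiency. 0 sorry; no new definitions, no named facts.

## References

* J. C. Robinson, W. Sadowski, Rend. Semin. Mat. Univ. Padova 131 (2014) 159–178, Corollaries 9–10.
  [RobinsonSadowski2014]
* J. C. Robinson, W. Sadowski, R. P. Silva, J. Math. Phys. 53 (2012) 115618. [RobinsonSadowskiSilva2012]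
* J. Leray, Acta Math. 63 (1934), §22 p. 227. [Leray1934]
* H. Bahouri, J.-Y. Chemin, R. Danchin, *Fourier Analysis and Nonlinear PDE*, Springer 2011, Thm. 1.38.
  [BahouriCheminDanchin2011]
-/

noncomputable section

open MeasureTheory Set Function Filter Topology Metric
open scoped ENNReal NNReal
open Literature.Analysis.FluidPDE Literature.Analysis.FunctionSpaces
open Literature.Analysis.FluidPDE.FluidComputer
open Summit.NavierStokesRegularity.NavierStokesRegularity.Theorems.FluidComputer (x5a_of_cascadeWitness')
open Summit.NavierStokesRegularity.FluidComputer.LeraySupClock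
open Summit.NavierStokesRegularity.FluidComputer.SobolevLadderFront

namespace Summit.NavierStokesRegularity.FluidComputer.HomSobolevLadder

/-- **L52, Lebesgue-exponent form.** For every `3 < r < ∞` there is `c > 0` such that along every maximal smooth
solution `(u, p)` of the unforced Navier–Stokes system on `ℝ³ × [0, T)` (`ν > 0`) which is Leray–Hopf from `u 0`, at
EVERY `t ∈ (0, T)`: `c · ν^{(r+3)/(2r)} · (T − t)^{−(r−3)/(2r)} ≤ ‖u(t)‖_{Ḣ^{3/2 − 3/r}}` (Leray's `L^r` clock L21′
`LeraySupClock.Lr_clock` and the embedding `Ḣ^{3/2−3/r} ⊂ L^r`, `eLpNorm_le_eHomSobolevSeminorm_of_lt_threeHalves`).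
[cite: RobinsonSadowski2014, Corollaries 9–10] [cite: Leray1934, §22 p. 227] [cite: BahouriCheminDanchin2011, Thm. 1.38] -/
theorem homSobolev_clock_exponent (r : ℝ) (hr : 3 < r) :
    ∃ c : ℝ, 0 < c ∧ ∀ (ν T : ℝ), 0 < ν → 0 < T →
      ∀ (u : ℝ → EuclideanSpace ℝ (Fin 3) → EuclideanSpace ℝ (Fin 3)) (p : ℝ → EuclideanSpace ℝ (Fin 3) → ℝ),
      IsMaximalSmoothSolution ν 0 u p T → IsLerayHopfOn T ν 0 (u 0) u →
      ∀ t ∈ Ioo 0 T,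
        ENNReal.ofReal (c * ν ^ ((r + 3) / (2 * r)) * (T - t) ^ (-((r - 3) / (2 * r)))) ≤
          Function.eHomSobolevSeminorm (3 / 2 - 3 / r) (EuclideanSpace.complexify ∘ u t) := by
  obtain ⟨c, hc, H⟩ := Lr_clock r hr
  have hr0 : 0 < r := by linarith
  have hs0 : 0 < 3 / 2 - 3 / r := by
    rw [sub_pos, div_lt_div_iff₀ hr0 two_pos]
    linarith
  have hs : 3 / 2 - 3 / r < 3 / 2 := by
    have : 0 < 3 / r := by positivity
    linarith
  obtain ⟨C, hC⟩ := eLpNorm_le_eHomSobolevSeminorm_of_lt_threeHalves (F := EuclideanSpace ℂ (Fin 3)) hs0 hs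
  set C' : ℝ≥0 := max C 1 with hC'
  have hC'pos : (0 : ℝ) < C' := by
    have : (1 : ℝ≥0) ≤ C' := le_max_right _ _
    exact lt_of_lt_of_le one_pos (by exact_mod_cast this)
  have hexp : ENNReal.ofReal (6 / (3 - 2 * (3 / 2 - 3 / r))) = ENNReal.ofReal r := by
    congr 1
    field_simp
    ring
  refine ⟨c / C', div_pos hc hC'pos, fun ν T hν hT u p hmax hLH t ht => ?_⟩
  set S : ℝ≥0∞ := Function.eHomSobolevSeminorm (3 / 2 - 3 / r) (EuclideanSpace.complexify ∘ u t) with hS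
  set X : ℝ := ν ^ ((r + 3) / (2 * r)) * (T - t) ^ (-((r - 3) / (2 * r))) with hX
  have h1 := H ν T hν hT u p hmax hLH t ht
  have h2mem : MemLp (EuclideanSpace.complexify ∘ u t) 2 volume :=
    memLp_complexify_comp (hLH.memLp t ⟨ht.1.le, ht.2.le⟩)
  have hnorm : eLpNorm (u t) (ENNReal.ofReal r) volume =
      eLpNorm (EuclideanSpace.complexify ∘ u t) (ENNReal.ofReal r) volume :=
    eLpNorm_congr_norm_ae (Eventually.of_forall fun x => (EuclideanSpace.norm_complexify (u t x)).symm)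
  have h2 := hC _ h2mem
  rw [hexp, ← hnorm] at h2
  have h3 : ENNReal.ofReal (c * X) ≤ (C' : ℝ≥0∞) * S := by
    have e : c * X = c * ν ^ ((r + 3) / (2 * r)) * (T - t) ^ (-((r - 3) / (2 * r))) := by rw [hX]; ring
    rw [e]
    refine (h1.trans h2).trans (mul_le_mul' ?_ le_rfl)
    exact_mod_cast le_max_left C 1
  have h4 : ENNReal.ofReal (c / C' * ν ^ ((r + 3) / (2 * r)) * (T - t) ^ (-((r - 3) / (2 * r)))) =
      ENNReal.ofReal (c * X) / C' := by
    have e : c / C' * ν ^ ((r + 3) / (2 * r)) * (T - t) ^ (-((r - 3) / (2 * r))) = c * X / C' := by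
      rw [hX]; ring
    rw [e, ENNReal.ofReal_div_of_pos hC'pos, ENNReal.ofReal_coe_nnreal]
  rw [h4, ENNReal.div_le_iff (by exact_mod_cast hC'pos.ne') ENNReal.coe_ne_top]
  calc ENNReal.ofReal (c * X) ≤ (C' : ℝ≥0∞) * S := h3
    _ = S * C' := mul_comm _ _

/-- **L52 — THE SOBOLEV LADDER IN `Ḣ^s` CURRENCY** (Robinson–Sadowski 2014 Cor. 10 / Robinson–Sadowski–Silva 2012 on
`ℝ³`, for the dictionary's class). For every `s ∈ (1/2, 3/2)` there is `c = c_s > 0` such that for every `ν > 0`,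
`T > 0` and every maximal smooth solution `(u, p)` of the unforced Navier–Stokes system on `ℝ³ × [0, T)` which is
Leray–Hopf from `u 0`, at EVERY `t ∈ (0, T)`:

  `c · ν^{(5−2s)/4} · (T − t)^{−(2s−1)/4} ≤ ‖u(t)‖_{Ḣ^s} = (∫ ‖ξ‖^{2s} ‖𝓕u(t)(ξ)‖² dξ)^{1/2}`

(`homSobolev_clock_exponent` at `r = 6/(3 − 2s)`; the seminorm is the tree's `Function.eHomSobolevSeminorm s` of
the complexified slice, `∞` off `Ḣ^s`, where the floor is trivial). No boundedness or decay hypothesis.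
[cite: RobinsonSadowski2014, Corollary 10] [cite: RobinsonSadowskiSilva2012, Thm. 1.1] [cite: Leray1934, §22 p. 227]
[cite: BahouriCheminDanchin2011, Thm. 1.38] -/
theorem homSobolev_clock (s : ℝ) (hs : s ∈ Ioo (1 / 2 : ℝ) (3 / 2)) :
    ∃ c : ℝ, 0 < c ∧ ∀ (ν T : ℝ), 0 < ν → 0 < T →
      ∀ (u : ℝ → EuclideanSpace ℝ (Fin 3) → EuclideanSpace ℝ (Fin 3)) (p : ℝ → EuclideanSpace ℝ (Fin 3) → ℝ),
      IsMaximalSmoothSolution ν 0 u p T → IsLerayHopfOn T ν 0 (u 0) u →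
      ∀ t ∈ Ioo 0 T,
        ENNReal.ofReal (c * ν ^ ((5 - 2 * s) / 4) * (T - t) ^ (-((2 * s - 1) / 4))) ≤
          Function.eHomSobolevSeminorm s (EuclideanSpace.complexify ∘ u t) := by
  set r : ℝ := 6 / (3 - 2 * s) with hr
  have h3 : 0 < 3 - 2 * s := by linarith [hs.2]
  have hr3 : 3 < r := by
    rw [hr, lt_div_iff₀ h3]
    linarith [hs.1]
  have e1 : (r + 3) / (2 * r) = (5 - 2 * s) / 4 := by
    rw [hr]
    field_simp
    ring
  have e2 : (r - 3) / (2 * r) = (2 * s - 1) / 4 := by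
    rw [hr]
    field_simp
    ring
  have e3 : 3 / 2 - 3 / r = s := by
    rw [hr]
    field_simp
    ring
  obtain ⟨c, hc, H⟩ := homSobolev_clock_exponent r hr3
  refine ⟨c, hc, fun ν T hν hT u p hmax hLH t ht => ?_⟩
  have h := H ν T hν hT u p hmax hLH t ht
  rw [e1, e2, e3] at h
  exact h

/-- **L52′ — THE `Ḣ^s` SEMINORMS DIVERGE AT THE LIFESPAN WITH A RATE**, `s ∈ (1/2, 3/2)`: along every maximal
smooth Leray–Hopf solution of the unforced system (`ν > 0`), `‖u(t)‖_{Ḣ^s} → ∞` as `t ↑ T` (from `homSobolev_clock`;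
at `s = 1/2` the divergence holds without a rate, `CriticalDivergence.eHomSobolevSeminorm_half_tendsto_top`).
[cite: RobinsonSadowski2014, Corollary 10] [cite: RobinsonSadowskiSilva2012, Thm. 1.1] -/
theorem homSobolev_tendsto_top (s : ℝ) (hs : s ∈ Ioo (1 / 2 : ℝ) (3 / 2)) {ν T : ℝ} (hν : 0 < ν) (hT : 0 < T)
    {u : ℝ → EuclideanSpace ℝ (Fin 3) → EuclideanSpace ℝ (Fin 3)} {p : ℝ → EuclideanSpace ℝ (Fin 3) → ℝ}
    (hmax : IsMaximalSmoothSolution ν 0 u p T) (hLH : IsLerayHopfOn T ν 0 (u 0) u) :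
    Tendsto (fun t => Function.eHomSobolevSeminorm s (EuclideanSpace.complexify ∘ u t)) (𝓝[<] T) (𝓝 ∞) := by
  obtain ⟨c, hc, H⟩ := homSobolev_clock s hs
  refine tendsto_nhds_top_mono
    (tendsto_ofReal_clock_top (a := (5 - 2 * s) / 4) (T := T) hc hν (by linarith [hs.1] : 0 < (2 * s - 1) / 4)) ?_
  filter_upwards [Ioo_mem_nhdsLT hT] with t ht
  exact H ν T hν hT u p hmax hLH t ht

/-- **L52 READ ON THE INTERFACE: every cascade witness blows up in every `Ḣ^s`, `1/2 < s < 3/2`, at the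
scaling-sharp rate.** Every `W : CascadeWitness` yields `ν > 0`, `T > 0` and a maximal smooth solution `(u, p)` of
the unforced Navier–Stokes system on `ℝ³ × [0, T)`, Leray–Hopf from `u 0` (`x5a_of_cascadeWitness'`), such that for
EVERY `s ∈ (1/2, 3/2)`, with the constant `c_s` of `homSobolev_clock`: `c_s ν^{(5−2s)/4} (T − t)^{−(2s−1)/4} ≤
‖u(t)‖_{Ḣ^s}` at every `t ∈ (0, T)` and `‖u(t)‖_{Ḣ^s} → ∞` as `t ↑ T`. Companion of
`SobolevLadderFace.ladder_face_of_cascadeWitness`. [cite: RobinsonSadowski2014, Corollary 10] -/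
theorem homSobolev_clock_of_cascadeWitness (W : CascadeWitness) :
    ∃ ν : ℝ, 0 < ν ∧ ∃ T : ℝ, 0 < T ∧
      ∃ (u : ℝ → EuclideanSpace ℝ (Fin 3) → EuclideanSpace ℝ (Fin 3)) (p : ℝ → EuclideanSpace ℝ (Fin 3) → ℝ),
        IsMaximalSmoothSolution ν 0 u p T ∧ IsLerayHopfOn T ν 0 (u 0) u ∧
        ∀ s : ℝ, ∀ hs : s ∈ Ioo (1 / 2 : ℝ) (3 / 2),
          (∀ t ∈ Ioo 0 T,
            ENNReal.ofReal ((homSobolev_clock s hs).choose * ν ^ ((5 - 2 * s) / 4) *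
              (T - t) ^ (-((2 * s - 1) / 4))) ≤
              Function.eHomSobolevSeminorm s (EuclideanSpace.complexify ∘ u t)) ∧
          Tendsto (fun t => Function.eHomSobolevSeminorm s (EuclideanSpace.complexify ∘ u t)) (𝓝[<] T) (𝓝 ∞) := by
  obtain ⟨ν, hν, T, hT, u, p, hmax, hLH, -⟩ := x5a_of_cascadeWitness' W
  refine ⟨ν, hν, T, hT, u, p, hmax, hLH, fun s hs => ⟨?_, homSobolev_tendsto_top s hs hν hT hmax hLH⟩⟩
  exact (homSobolev_clock s hs).choose_spec.2 ν T hν hT u p hmax hLH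

end Summit.NavierStokesRegularity.FluidComputer.HomSobolevLadder

end
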